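import Summits.FinalStateConjecture.FinalStateConjecture.Theses.ZeroEnergyKerrOrBomb
import Literature.Geometry.Lorentzian.KillingModeStability
import Literature.Geometry.Lorentzian.ZeroEnergyRayTrappedModFlow
import Literature.Geometry.Lorentzian.LinearizedRicci
import Literature.Geometry.Lorentzian.KerrConvergence
import Literature.Geometry.Lorentzian.Genericity

/-!
# Sketch — crux-ideate `stmt-FinalStateConjecture-10021` (StationaryLimitReduction), ideator 1

First lemmas of the two crux idea cards `one-locked-explosion` and `kerr-avoidance-dichotomy`,
typed over existing declarations. Nothing here is a route item.
-/

noncomputable section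

open scoped Manifold ContDiff Topology
open Set Filter Literature.Geometry.Lorentzian

namespace Summit.FinalStateConjecture.FinalStateConjecture.Cruxes.StationaryLimitReduction.Ideator1

/-! ## Card `one-locked-explosion` -/

section LocalEscape

variable {E : Type*} [NormedAddCommGroup E] [NormedSpace ℝ E] {H : Type*} [TopologicalSpace H]
  {I : ModelWithCorners ℝ E H} {X : Type*} [TopologicalSpace X] [ChartedSpace H X]
  [IsManifold I ∞ X]

/-- **Local escape suffices** (first lemma of `one-locked-explosion`): Christodoulou genericity of
codimension `1` follows as soon as through every exceptional admissible datum there is an admissible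
smooth injective one-parameter family whose members are good on a PUNCTURED NEIGHBOURHOOD of the
parameter `0` (reparametrise `ℝ → (−ε, ε)` by a smooth injective contraction). -/
def LocalEscapeSuffices : Prop :=
  ∀ (𝓓 : Set (InitialDataSet I X)) (P : InitialDataSet I X → Prop),
    (∀ d ∈ 𝓓, ¬ P d → ∃ F : EuclideanSpace ℝ (Fin 1) → InitialDataSet I X,
      InitialDataSet.IsSmoothDataFamily 1 F ∧ F 0 = d ∧ Function.Injective F ∧ (∀ c, F c ∈ 𝓓) ∧
        ∃ ε : ℝ, 0 < ε ∧ ∀ c, c ≠ 0 → ‖c‖ < ε → P (F c)) →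
    InitialDataSet.IsChristodoulouGeneric 𝓓 P 1

end LocalEscape

/-- **Flat phase-locking** (the elementary real-analysis input of `one-locked-explosion`): for every
real `α` the function `s ↦ e^{-1/s²} cos(α / s²)` (value `0` at `s = 0`) is `C^∞` on `ℝ` — a
flat reparametrisation can absorb the logarithmically divergent ejection phase `(ω/ν) log(1/c)` of a
complex unstable pair. -/
def FlatPhaseLocking : Prop :=
  ∀ α : ℝ, ContDiff ℝ (⊤ : ℕ∞) (fun s : ℝ ↦ if s = 0 then (0 : ℝ)
    else Real.exp (-(1 / s ^ 2)) * Real.cos (α / s ^ 2))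

/-- **Spin-raising bridge** (the stub of `one-locked-explosion` where the SCALAR typing of
`KerrOrBomb` bites): an admissible stationary vacuum hole (telescope of the target) which is NOT
Killing-mode stable for `□_g` carries an exponentially growing Killing-mode pair of LINEARISED
GRAVITY `DRic_g(h) = 0` which is not pure gauge on the d.o.c. (regularity at `𝓗⁺` and the
outgoing/boundedness clause are left to crux-plan; `h₁, h₂` real and imaginary parts). -/
def SpinRaisingBridge : Prop :=
  ∀ (𝓑 : StationaryAFBlackHole.{0}) [𝓑.metric.HasLeviCivita],
    𝓑.metric.toPseudoRiemannianMetric.IsRicciFlat → IsConnected 𝓑.horizon →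
    𝓑.toSpacetime.IsNonDegenerateHorizon 𝓑.Mext →
    𝓑.metric.IsGloballyHyperbolic 𝓑.timeOrientation → (∀ p ∈ 𝓑.doc, 𝓑.killing p ≠ 0) →
    ¬ 𝓑.IsKillingModeStable →
    ∃ (ν ϖ : ℝ) (h₁ h₂ : Π x : 𝓑.carrier,
        TangentSpace (𝓡 4) x →L[ℝ] TangentSpace (𝓡 4) x →L[ℝ] ℝ),
      0 < ν ∧
      (∀ x ∈ 𝓑.doc, 𝓑.metric.toPseudoRiemannianMetric.linearizedRicciCLM h₁ x = 0 ∧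
        𝓑.metric.toPseudoRiemannianMetric.linearizedRicciCLM h₂ x = 0) ∧
      (∀ x ∈ 𝓑.doc,
        𝓑.metric.toPseudoRiemannianMetric.lieDerivBilin 𝓑.killing h₁ x = ν • h₁ x - ϖ • h₂ x ∧
        𝓑.metric.toPseudoRiemannianMetric.lieDerivBilin 𝓑.killing h₂ x = ϖ • h₁ x + ν • h₂ x) ∧
      ¬ ∃ Y : Π x : 𝓑.carrier, TangentSpace (𝓡 4) x,
        ∀ x ∈ 𝓑.doc, h₁ x = 𝓑.metric.toPseudoRiemannianMetric.lieDerivBilin Y 𝓑.metric.val x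

/-! ## Card `kerr-avoidance-dichotomy` -/

/-- **Where `KerrOrBomb` is consumed** (proved): on the Kerr-AVOIDING branch every admissible
ω-limit hole is a scalar bomb — literally the contrapositive of the target. -/
theorem kerrAvoiding_limits_are_bombs
    (hKOB : Summit.FinalStateConjecture.FinalStateConjecture.Theses.ZeroEnergyKerrOrBomb.KerrOrBomb)
    (𝓑 : StationaryAFBlackHole.{0}) [𝓑.metric.HasLeviCivita] [Kerr.Facts]
    (hRic : 𝓑.metric.toPseudoRiemannianMetric.IsRicciFlat) (hconn : IsConnected 𝓑.horizon)
    (hnd : 𝓑.toSpacetime.IsNonDegenerateHorizon 𝓑.Mext)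
    (hgh : 𝓑.metric.IsGloballyHyperbolic 𝓑.timeOrientation) (hT : ∀ p ∈ 𝓑.doc, 𝓑.killing p ≠ 0)
    (hfar : ¬ ∃ (M a : ℝ), Kerr.IsSubextremal M a ∧ ∃ Ψ : Kerr.exterior M a → 𝓑.carrier,
      Function.Injective Ψ ∧ Set.range Ψ = 𝓑.doc ∧
      PseudoRiemannianMetric.IsIsometricImmersion
        (Kerr.smoothMetric M a (Kerr.rPlus M a)).toPseudoRiemannianMetric
        𝓑.metric.toPseudoRiemannianMetric Ψ) :
    ¬ 𝓑.IsKillingModeStable := by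
  intro hstable
  apply hfar
  rw [StationaryAFBlackHole.isKillingModeStable_iff] at hstable
  exact hKOB 𝓑 hRic hconn hnd hgh hT hstable

/-- **Uniform isolation of Kerr among admissible stationary vacuum holes** (first lemma of
`kerr-avoidance-dichotomy`; quantitative Alexakis–Ionescu–Klainerman perturbative rigidity read in a
`T`-equivariant candidate chart): for every sub-extremal `(M, a)` there are `ε > 0` and a near-zone
radius `R` such that an admissible hole whose metric, pulled back by a `T`-equivariant injective
chart of the Kerr exterior covering the d.o.c., is `ε`-close in `C³` to `g_{M,a}` on the truncated
slab `{t* = 0, r ≤ R}`, is (fact-free) isometric to SOME sub-extremal Kerr exterior. With `Ω`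
connected this makes "is Kerr" clopen on the late-time ω-limit set. -/
def UniformKerrIsolation : Prop :=
  ∀ (M a : ℝ), Kerr.IsSubextremal M a → ∃ ε : ℝ, 0 < ε ∧ ∃ R : ℝ, 0 < R ∧
    ∀ (𝓑 : StationaryAFBlackHole.{0}) [𝓑.metric.HasLeviCivita] [Kerr.Facts],
      𝓑.metric.toPseudoRiemannianMetric.IsRicciFlat → IsConnected 𝓑.horizon →
      𝓑.toSpacetime.IsNonDegenerateHorizon 𝓑.Mext →
      𝓑.metric.IsGloballyHyperbolic 𝓑.timeOrientation → (∀ p ∈ 𝓑.doc, 𝓑.killing p ≠ 0) →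
      ∀ Ψ : Kerr.exterior M a → 𝓑.carrier, Function.Injective Ψ → 𝓑.doc ⊆ Set.range Ψ →
        ContMDiff 𝓘(ℝ, E4) (𝓡 4) ((⊤ : ℕ∞) : WithTop ℕ∞) Ψ →
        (∀ x : Kerr.exterior M a,
          mfderiv 𝓘(ℝ, E4) (𝓡 4) Ψ x (Kerr.stationaryField a (Kerr.rPlus M a) x) =
            𝓑.killing (Ψ x)) →
        𝓑.toSpacetime.truncDeviationCk (Kerr.background M a) Ψ 3 R 0 ≤ ENNReal.ofReal ε →
        ∃ (M' a' : ℝ), Kerr.IsSubextremal M' a' ∧ ∃ Ψ' : Kerr.exterior M' a' → 𝓑.carrier,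
          Function.Injective Ψ' ∧ Set.range Ψ' = 𝓑.doc ∧
          PseudoRiemannianMetric.IsIsometricImmersion
            (Kerr.smoothMetric M' a' (Kerr.rPlus M' a')).toPseudoRiemannianMetric
            𝓑.metric.toPseudoRiemannianMetric Ψ'

/-- **Whiting from geometry** (the spin-blind factorisation of the bridge, optional stub shared by
both cards): an admissible stationary vacuum hole with NO zero-energy null geodesic trapped modulo
the stationary flow is Killing-mode stable for `□_g` (Kerr: Γ₀ = ∅ by Carter separation and
Whiting 1989). Contrapositive: a scalar bomb certifies a trapped zero-energy ray, a spin-blind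
object. -/
def WhitingFromGeometry : Prop :=
  ∀ (𝓑 : StationaryAFBlackHole.{0}) [𝓑.metric.HasLeviCivita],
    𝓑.metric.toPseudoRiemannianMetric.IsRicciFlat → IsConnected 𝓑.horizon →
    𝓑.toSpacetime.IsNonDegenerateHorizon 𝓑.Mext →
    𝓑.metric.IsGloballyHyperbolic 𝓑.timeOrientation → (∀ p ∈ 𝓑.doc, 𝓑.killing p ≠ 0) →
    ¬ 𝓑.HasZeroEnergyRayTrappedModFlow → 𝓑.IsKillingModeStable

end Summit.FinalStateConjecture.FinalStateConjecture.Cruxes.StationaryLimitReduction.Ideator1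

end
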